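import Mathlib
import HarnessLib
import Summits.NavierStokesRegularity.NavierStokesRegularity.Theorems.HalfSpaceWindowDoorCirculationCarryingRigidityPlanarEnergy
import Summits.NavierStokesRegularity.NavierStokesRegularity.Theorems.HalfSpaceWindowDoorCirculationCarryingRigidityWindowedFlux

/-!
# Route `HalfSpaceWindowDoor`, crux `CirculationCarryingRigidity` (stmt-NavierStokesRegularity-25311) — census row in the TIME-ONLY
# class: VANISHING ANNULAR SWIRL MEAN on densely many planes ⇒ poloidal (the sharp kinematic form of `…PlanarEnergy`)

LEAD ns-hsw-p1 g6 (cell pub-ns-dss), `--supports 25311 --as helper`.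

The planar `L²` row of `…PlanarEnergy` is the case `p = 2` of the following kinematic floor: if on a horizontal plane the trace of the
slice has annular `L¹`-mean `o(R)` along SOME sequence of annuli `{R < |y| ≤ 2R}`, `R → ∞`, then the disc circulation `Γ(·,c,s)`
vanishes identically on that plane — because `∫_R^{2R} Γ(ρ,c,s)dρ ≤ ∫_{R<|y|≤2R}‖v(s)(y,c)‖dy` (`Γ ≤ ρ∫₀^{2π}‖v‖dθ`,
`…PlanarEnergy.circ_le_mul_integral_norm`, and polar coordinates on the annulus, `integral_annulus_eq_polar`) while `Γ` is non-negative
and non-decreasing (`…CircMonotone.circ_mono`), so `Γ(r₀) = γ > 0` would force `∫_{R<|y|≤2R}‖v‖ ≥ γR` for all `R ≥ r₀`.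

* `integral_annulus_eq_polar` — `∫_{R<|y|≤2R}‖v(s)(y,c)‖dy = ∫_R^{2R} ρ∫₀^{2π}‖v(s)(cylPt ρ θ c)‖dθ dρ`;
* `circ_eq_zero_of_annularMean`, `circ_eq_zero_of_annularMean_dense` — `Γ ≡ 0` on such planes / on all planes when they are dense in height;
* `inner_curl_e3_eq_zero_of_annularMean_dense` — **CENSUS THEOREM**: door class + `ω₃ ≥ 0` + (at every `s < 0`, for a DENSE set of heights,
  `∀ ε > 0 ∀ R₀ ∃ R ≥ R₀: ∫_{R<|y|≤2R}‖v(s)(y,c)‖dy ≤ εR`) ⇒ POLOIDAL.  This covers every planar `L^p` trace with `p ≤ 2` (Hölder), every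
  tail `|v_h| = o(1/|x_h|)`, and is SHARP in the sense that the circulation-carrying enemy has annular mean `≥ (Φ₀ − o(1))·R` on every
  plane at every time: its horizontal speed is, in annular `L¹`-mean, at least that of the point vortex `Φ₀/(2π|x_h|)`.

WHAT THIS IS NOT: not a statement about Navier–Stokes regularity (Clay A); door statements are regularity CRITERIA about HYPOTHETICAL
blow-up profiles; item 25311 stays OPEN at its research stub.
-/

noncomputable section

-- the summit and its single sub-problem share the name (CONVENTIONS §1), as in every Theorems file
set_option linter.dupNamespace false

namespace Summit.NavierStokesRegularity.NavierStokesRegularity.Theorems.HalfSpaceWindowDoorCirculationCarryingRigidityAnnularMean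

open Set Function Filter MeasureTheory Topology intervalIntegral
open scoped InnerProductSpace RealInnerProductSpace
open Literature.Analysis Literature.Analysis.FluidPDE
open Summit.NavierStokesRegularity.NavierStokesRegularity.Theorems.HalfSpaceWindowDoorCirculationCarryingRigidityDefs (planePt)
open Summit.NavierStokesRegularity.NavierStokesRegularity.Theorems.AxisTwistDoorAveragedConeLiouvilleDefs (cylPt eT circ SignE3)
open Summit.NavierStokesRegularity.NavierStokesRegularity.Theorems.AveragedConeLiouville.CircMonotone (circ_nonneg circ_mono)
open Summit.NavierStokesRegularity.NavierStokesRegularity.Theorems.HalfSpaceWindowDoorCirculationCarryingRigidityAxisCirculation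
  (isSmoothSpaceTimeOn_of_class)
open Summit.NavierStokesRegularity.NavierStokesRegularity.Theorems.HalfSpaceWindowDoorCirculationCarryingRigidityEddyTorqueOneSidedLiouville
  (poloidal_of_circF_eq_zero)
open Summit.NavierStokesRegularity.NavierStokesRegularity.Theorems.HalfSpaceWindowDoorCirculationCarryingRigidityWindowedFlux (continuous_planePt)
open Summit.NavierStokesRegularity.NavierStokesRegularity.Theorems.HalfSpaceWindowDoorCirculationCarryingRigidityPlanarEnergy

variable {v : ℝ → EuclideanSpace ℝ (Fin 3) → EuclideanSpace ℝ (Fin 3)}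

/-! ### Polar coordinates on annuli and the annular-mean row -/

/-- The angular speed `θ ↦ ‖v(s)(cylPt ρ θ c)‖` is `2π`-periodic. -/
theorem periodic_norm_cylPt (s c ρ : ℝ) :
    Function.Periodic (fun θ : ℝ => ‖v s (cylPt ρ θ c)‖) (2 * Real.pi) := by
  intro θ
  simp only [← planePt_circlePt, periodic_circlePt ρ θ]

/-- `ρ ↦ ρ·∫₀^{2π}‖v(s)(cylPt ρ θ c)‖dθ` is continuous for a continuous slice. -/
theorem continuous_radial_speed {s : ℝ} (hv : Continuous (v s)) (c : ℝ) :
    Continuous fun ρ : ℝ => ρ * ∫ θ in (0 : ℝ)..(2 * Real.pi), ‖v s (cylPt ρ θ c)‖ := by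
  have hj : Continuous fun p : ℝ × ℝ => cylPt p.1 p.2 c :=
    (AveragedConeLiouville.CircleStokes.contDiff_cylPt c (n := 0)).continuous.comp (continuous_snd.prodMk continuous_fst)
  have hf : Continuous (Function.uncurry fun (ρ θ : ℝ) => ‖v s (cylPt ρ θ c)‖) := (hv.comp hj).norm
  exact continuous_id.mul (intervalIntegral.continuous_parametric_intervalIntegral_of_continuous' hf 0 (2 * Real.pi))

/-- **Polar coordinates on an annulus.**  For `R > 0`:
`∫_{R<|y|≤2R} ‖v(s)(y,c)‖ dy = ∫_R^{2R} ρ ∫₀^{2π} ‖v(s)(cylPt ρ θ c)‖ dθ dρ`. -/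
theorem integral_annulus_eq_polar {s c R : ℝ} (hR : 0 < R) (hv : Continuous (v s)) :
    ∫ y in Metric.closedBall (0 : EuclideanSpace ℝ (Fin 2)) (2 * R) \ Metric.closedBall 0 R, ‖v s (planePt c y)‖ =
      ∫ ρ in R..(2 * R), ρ * ∫ θ in (0 : ℝ)..(2 * Real.pi), ‖v s (cylPt ρ θ c)‖ := by
  set A : Set (EuclideanSpace ℝ (Fin 2)) := Metric.closedBall 0 (2 * R) \ Metric.closedBall 0 R with hA
  have hAm : MeasurableSet A := measurableSet_closedBall.diff measurableSet_closedBall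
  set f : EuclideanSpace ℝ (Fin 2) → ℝ := fun y => ‖v s (planePt c y)‖ with hf
  have hfc : Continuous f := (hv.comp (continuous_planePt c)).norm
  have hfi : Integrable (A.indicator f) := by
    rw [integrable_indicator_iff hAm]
    exact (hfc.continuousOn.integrableOn_compact (isCompact_closedBall (0 : EuclideanSpace ℝ (Fin 2)) (2 * R))).mono_set
      (fun y hy => hy.1)
  rw [← MeasureTheory.integral_indicator hAm, integral_eq_integral_circlePt hfi]
  -- the inner angular integral, as a function of `ρ > 0`
  have hinner : ∀ ρ ∈ Ioi (0 : ℝ), (∫ θ in Ioc (-Real.pi) Real.pi, ρ • A.indicator f (circlePt ρ θ)) =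
      (Ioc R (2 * R)).indicator (fun ρ => ρ * ∫ θ in (0 : ℝ)..(2 * Real.pi), ‖v s (cylPt ρ θ c)‖) ρ := by
    intro ρ hρ
    have hρ0 : 0 < ρ := hρ
    have hmem : ∀ θ : ℝ, circlePt ρ θ ∈ A ↔ ρ ∈ Ioc R (2 * R) := by
      intro θ
      simp only [hA, Set.mem_sdiff, Metric.mem_closedBall, dist_zero_right, norm_circlePt, abs_of_pos hρ0, mem_Ioc, not_le]
      tauto
    by_cases hρA : ρ ∈ Ioc R (2 * R)
    · rw [indicator_of_mem hρA]
      have hpt : ∀ θ : ℝ, ρ • A.indicator f (circlePt ρ θ) = ρ * ‖v s (cylPt ρ θ c)‖ := by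
        intro θ
        rw [indicator_of_mem ((hmem θ).2 hρA), smul_eq_mul, hf]
        simp only [planePt_circlePt]
      simp_rw [hpt]
      rw [MeasureTheory.integral_const_mul]
      congr 1
      rw [← intervalIntegral.integral_of_le (by linarith [Real.pi_pos] : -Real.pi ≤ Real.pi)]
      have hper := (periodic_norm_cylPt (v := v) s c ρ).intervalIntegral_add_eq (-Real.pi) 0
      simp only [zero_add] at hper
      rw [← hper]
      congr 1
      ring
    · rw [indicator_of_notMem hρA]
      have hpt : ∀ θ : ℝ, ρ • A.indicator f (circlePt ρ θ) = 0 := by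
        intro θ
        rw [indicator_of_notMem (fun h => hρA ((hmem θ).1 h)), smul_zero]
      simp_rw [hpt]
      exact integral_zero _ _
  rw [setIntegral_congr_fun measurableSet_Ioi hinner, setIntegral_indicator measurableSet_Ioc]
  have hsub : Ioi (0 : ℝ) ∩ Ioc R (2 * R) = Ioc R (2 * R) := by
    ext ρ
    simp only [mem_inter_iff, mem_Ioi, mem_Ioc]
    constructor
    · rintro ⟨-, h⟩; exact h
    · rintro ⟨h1, h2⟩; exact ⟨hR.trans h1, h1, h2⟩
  rw [hsub, ← intervalIntegral.integral_of_le (by linarith)]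

/-- **`Γ ≡ 0` on a plane with vanishing annular swirl mean.**  For a `C¹` slice with `ω₃ ≥ 0`: if along annuli of arbitrarily large
radius the plane trace has small `L¹`-mean, `∫_{R<|y|≤2R}‖v(s)(y,c)‖dy ≤ εR`, then `Γ(r,c,s) = 0` for every `r ≥ 0`. -/
theorem circ_eq_zero_of_annularMean {s c : ℝ} (hs : s < 0) (hv1 : ContDiff ℝ 1 (v s)) (hsign : SignE3 v)
    (htail : ∀ ε : ℝ, 0 < ε → ∀ R₀ : ℝ, ∃ R : ℝ, R₀ ≤ R ∧ 0 < R ∧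
      ∫ y in Metric.closedBall (0 : EuclideanSpace ℝ (Fin 2)) (2 * R) \ Metric.closedBall 0 R, ‖v s (planePt c y)‖ ≤ ε * R) :
    ∀ r : ℝ, 0 ≤ r → circ v r c s = 0 := by
  have hvc : Continuous (v s) := hv1.continuous
  by_contra hcon
  push Not at hcon
  obtain ⟨r₀, hr₀, hne⟩ := hcon
  have hγ : 0 < circ v r₀ c s := lt_of_le_of_ne (circ_nonneg v hv1 hsign hs hr₀ c) (Ne.symm hne)
  set γ := circ v r₀ c s with hγdef
  obtain ⟨R, hR₀, hR, hsmall⟩ := htail (γ / 2) (by positivity) r₀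
  have hR2 : R ≤ 2 * R := by linarith
  -- lower bound: `∫_R^{2R} Γ ≥ γ R`
  have hΓc : Continuous fun ρ => circ v ρ c s :=
    (AveragedConeLiouville.CircleStokes.differentiable_circ v hv1 c).continuous
  have hlow : γ * R ≤ ∫ ρ in R..(2 * R), circ v ρ c s := by
    have h : ∫ ρ in R..(2 * R), γ ≤ ∫ ρ in R..(2 * R), circ v ρ c s :=
      intervalIntegral.integral_mono_on hR2 ((continuous_const (y := γ)).intervalIntegrable (μ := volume) _ _)
        (hΓc.intervalIntegrable _ _) (fun ρ hρ => circ_mono v hv1 hsign hs hr₀ (hR₀.trans hρ.1) c)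
    rw [intervalIntegral.integral_const, smul_eq_mul] at h
    linarith [h]
  -- upper bound: `∫_R^{2R} Γ ≤ ∫_{annulus} ‖v‖ ≤ γR/2`
  have hup : ∫ ρ in R..(2 * R), circ v ρ c s ≤ γ / 2 * R := by
    calc ∫ ρ in R..(2 * R), circ v ρ c s
        ≤ ∫ ρ in R..(2 * R), ρ * ∫ θ in (0 : ℝ)..(2 * Real.pi), ‖v s (cylPt ρ θ c)‖ :=
          intervalIntegral.integral_mono_on hR2 (hΓc.intervalIntegrable _ _)
            ((continuous_radial_speed hvc c).intervalIntegrable _ _)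
            fun ρ hρ => circ_le_mul_integral_norm (hR.le.trans hρ.1) hvc
      _ = ∫ y in Metric.closedBall (0 : EuclideanSpace ℝ (Fin 2)) (2 * R) \ Metric.closedBall 0 R, ‖v s (planePt c y)‖ :=
          (integral_annulus_eq_polar hR hvc).symm
      _ ≤ γ / 2 * R := hsmall
  nlinarith

/-- **`Γ ≡ 0` at a time whose planes of vanishing annular swirl mean are dense in height.** -/
theorem circ_eq_zero_of_annularMean_dense {s : ℝ} (hs : s < 0) (hv1 : ContDiff ℝ 1 (v s)) (hsign : SignE3 v)
    (hdense : Dense {c : ℝ | ∀ ε : ℝ, 0 < ε → ∀ R₀ : ℝ, ∃ R : ℝ, R₀ ≤ R ∧ 0 < R ∧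
      ∫ y in Metric.closedBall (0 : EuclideanSpace ℝ (Fin 2)) (2 * R) \ Metric.closedBall 0 R, ‖v s (planePt c y)‖ ≤ ε * R}) :
    ∀ r : ℝ, 0 ≤ r → ∀ c : ℝ, circ v r c s = 0 := by
  intro r hr
  have hclosed : IsClosed {c : ℝ | circ v r c s = 0} := isClosed_eq (continuous_circ_height hv1.continuous r) continuous_const
  have hsub : {c : ℝ | ∀ ε : ℝ, 0 < ε → ∀ R₀ : ℝ, ∃ R : ℝ, R₀ ≤ R ∧ 0 < R ∧
      ∫ y in Metric.closedBall (0 : EuclideanSpace ℝ (Fin 2)) (2 * R) \ Metric.closedBall 0 R, ‖v s (planePt c y)‖ ≤ ε * R} ⊆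
      {c : ℝ | circ v r c s = 0} :=
    fun c hc => circ_eq_zero_of_annularMean hs hv1 hsign hc r hr
  have huniv : {c : ℝ | circ v r c s = 0} = univ := by
    apply eq_univ_of_univ_subset
    rw [← (hdense.mono hsub).closure_eq]
    exact closure_minimal subset_rfl hclosed
  intro c
  have := huniv ▸ mem_univ c
  exact this

/-- **CENSUS THEOREM (vanishing annular swirl mean ⇒ poloidal), the sharp kinematic row of the TIME-ONLY class.**  A profile of the
route's Type-I ancient Oseen-mild class with `ω₃ ≥ 0` such that at every time `s < 0`, for a DENSE set of heights `c`, the plane trace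
has vanishing annular `L¹`-mean along some sequence of radii (`∀ ε > 0 ∀ R₀ ∃ R ≥ R₀, ∫_{R<|y|≤2R}‖v(s)(y,c)‖dy ≤ εR`) is POLOIDAL.
Every planar `L^p` trace with `p ≤ 2` and every tail `|v_h| = o(1/|x_h|)` satisfies the hypothesis; the enemy's annular mean is `≳ Φ₀R`. -/
theorem inner_curl_e3_eq_zero_of_annularMean_dense (C : ℝ)
    (v : ℝ → EuclideanSpace ℝ (Fin 3) → EuclideanSpace ℝ (Fin 3))
    (hrate : HasTypeITimeDecay C v)
    (hcont : ContinuousOn (uncurry v) (Iio (0 : ℝ) ×ˢ univ))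
    (hmild : ∀ s t : ℝ, s < t → t < 0 → ∀ x,
      v t x = UnboundedOperators.heatExtension (v s) (t - s) x - oseenDuhamel 1 s v v t x)
    (hdiv : ∀ t < 0, VectorCalculus.IsDivFree (v t))
    (hsign : ∀ s < 0, ∀ y, 0 ≤ ⟪curl (v s) y, (EuclideanSpace.single (2 : Fin 3) (1 : ℝ))⟫_ℝ)
    (htail : ∀ s < 0, Dense {c : ℝ | ∀ ε : ℝ, 0 < ε → ∀ R₀ : ℝ, ∃ R : ℝ, R₀ ≤ R ∧ 0 < R ∧
      ∫ y in Metric.closedBall (0 : EuclideanSpace ℝ (Fin 2)) (2 * R) \ Metric.closedBall 0 R, ‖v s (planePt c y)‖ ≤ ε * R}) :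
    ∀ s < 0, ∀ y, ⟪curl (v s) y, (EuclideanSpace.single (2 : Fin 3) (1 : ℝ))⟫_ℝ = 0 := by
  have hsm : IsSmoothSpaceTimeOn (Iio (0 : ℝ)) v := isSmoothSpaceTimeOn_of_class hrate hcont hmild hdiv
  have hsign' : SignE3 v := hsign
  refine poloidal_of_circF_eq_zero hrate hcont hmild hdiv hsign' fun t ht x => ?_
  have hv1 : ContDiff ℝ 1 (v t) := (hsm.contDiff_slice ht).of_le (by norm_cast)
  rw [circ_eq_zero_of_annularMean_dense ht hv1 hsign' (htail t ht) (cylRadius x) (cylRadius_nonneg x) (x 2), mul_zero]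

/-! ### Appendix (same seat): the POINT-VORTEX LOWER BOUND IN ANNULAR MEAN — the far field of the enemy, quantitatively -/

/-- **`R·Γ(r,c,s) ≤ ∫_{R<|y|≤2R}‖v(s)(y,c)‖dy` for all `R ≥ r ≥ 0`, `R > 0`** (a `C¹` slice with `ω₃ ≥ 0`).  In words: on every plane and at
every radius beyond `r`, the annular `L¹`-mean of the horizontal speed is at least the circulation already enclosed at radius `r` — the
swirl of a circulation-carrying closed-hemisphere profile is, in annular mean, at least that of the point vortex `Γ(r,c,s)/(2π|x_h|)`. -/
theorem circ_mul_le_integral_annulus {s c r R : ℝ} (hs : s < 0) (hv1 : ContDiff ℝ 1 (v s)) (hsign : SignE3 v)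
    (hr : 0 ≤ r) (hrR : r ≤ R) (hR : 0 < R) :
    circ v r c s * R ≤
      ∫ y in Metric.closedBall (0 : EuclideanSpace ℝ (Fin 2)) (2 * R) \ Metric.closedBall 0 R, ‖v s (planePt c y)‖ := by
  have hvc : Continuous (v s) := hv1.continuous
  have hR2 : R ≤ 2 * R := by linarith
  have hΓc : Continuous fun ρ => circ v ρ c s :=
    (AveragedConeLiouville.CircleStokes.differentiable_circ v hv1 c).continuous
  -- `∫_R^{2R} Γ(r) dρ ≤ ∫_R^{2R} Γ(ρ) dρ` by monotonicity of `Γ`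
  have hlow : circ v r c s * R ≤ ∫ ρ in R..(2 * R), circ v ρ c s := by
    have h : ∫ ρ in R..(2 * R), circ v r c s ≤ ∫ ρ in R..(2 * R), circ v ρ c s :=
      intervalIntegral.integral_mono_on hR2 ((continuous_const (y := circ v r c s)).intervalIntegrable (μ := volume) _ _)
        (hΓc.intervalIntegrable _ _) (fun ρ hρ => circ_mono v hv1 hsign hs hr (hrR.trans hρ.1) c)
    rw [intervalIntegral.integral_const, smul_eq_mul] at h
    linarith [h]
  -- `∫_R^{2R} Γ(ρ) dρ ≤ ∫_R^{2R} ρ∫‖v‖dθ dρ = ∫_{annulus} ‖v‖`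
  calc circ v r c s * R ≤ ∫ ρ in R..(2 * R), circ v ρ c s := hlow
    _ ≤ ∫ ρ in R..(2 * R), ρ * ∫ θ in (0 : ℝ)..(2 * Real.pi), ‖v s (cylPt ρ θ c)‖ :=
        intervalIntegral.integral_mono_on hR2 (hΓc.intervalIntegrable _ _)
          ((continuous_radial_speed hvc c).intervalIntegrable _ _)
          fun ρ hρ => circ_le_mul_integral_norm (hR.le.trans hρ.1) hvc
    _ = ∫ y in Metric.closedBall (0 : EuclideanSpace ℝ (Fin 2)) (2 * R) \ Metric.closedBall 0 R, ‖v s (planePt c y)‖ :=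
        (integral_annulus_eq_polar hR hvc).symm

/-- **The far field of a door-class closed-hemisphere profile, quantitatively.**  For a profile of the route's Type-I ancient
Oseen-mild class with `ω₃ ≥ 0`: at every time `s < 0`, on every horizontal plane `{x₃ = c}`, for all `0 ≤ r ≤ R`, `0 < R`,
`R·Γ(r,c,s) ≤ ∫_{R<|y|≤2R}‖v(s)(y,c)‖dy` — whatever circulation a disc encloses is paid for, at every larger scale, by horizontal speed
of annular mean at least that of the corresponding point vortex. -/
theorem circ_mul_le_integral_annulus_of_class (C : ℝ)
    (v : ℝ → EuclideanSpace ℝ (Fin 3) → EuclideanSpace ℝ (Fin 3))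
    (hrate : HasTypeITimeDecay C v)
    (hcont : ContinuousOn (uncurry v) (Iio (0 : ℝ) ×ˢ univ))
    (hmild : ∀ s t : ℝ, s < t → t < 0 → ∀ x,
      v t x = UnboundedOperators.heatExtension (v s) (t - s) x - oseenDuhamel 1 s v v t x)
    (hdiv : ∀ t < 0, VectorCalculus.IsDivFree (v t))
    (hsign : ∀ s < 0, ∀ y, 0 ≤ ⟪curl (v s) y, (EuclideanSpace.single (2 : Fin 3) (1 : ℝ))⟫_ℝ)
    {s c r R : ℝ} (hs : s < 0) (hr : 0 ≤ r) (hrR : r ≤ R) (hR : 0 < R) :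
    circ v r c s * R ≤
      ∫ y in Metric.closedBall (0 : EuclideanSpace ℝ (Fin 2)) (2 * R) \ Metric.closedBall 0 R, ‖v s (planePt c y)‖ := by
  have hsm : IsSmoothSpaceTimeOn (Iio (0 : ℝ)) v := isSmoothSpaceTimeOn_of_class hrate hcont hmild hdiv
  have hsign' : SignE3 v := hsign
  have hv1 : ContDiff ℝ 1 (v s) := (hsm.contDiff_slice hs).of_le (by norm_cast)
  exact circ_mul_le_integral_annulus hs hv1 hsign' hr hrR hR

/-! ### Appendix 2 (same seat): the FAR-PAST form — the annular-mean hypothesis before some epoch already forces a poloidal slab -/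

/-- **FAR-PAST FORM of the annular-mean row.**  If the annular-mean hypothesis (dense heights of vanishing annular swirl mean) holds
only at the times `s < s₁` of a far-past ray (`s₁ < 0`), the profile is still poloidal on the WHOLE slab: the past time shift
`v(· + s₁)` is again in the class (`…CriticalStretchingAnalytic.timeShift_class`), the row applies to it, and real-analyticity in time
(`…CriticalStretchingAnalytic.inner_curl_e3_eq_zero_of_far_past`) propagates `ω₃ ≡ 0` forward. -/
theorem inner_curl_e3_eq_zero_of_annularMean_farPast (C : ℝ)
    (v : ℝ → EuclideanSpace ℝ (Fin 3) → EuclideanSpace ℝ (Fin 3))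
    (hrate : HasTypeITimeDecay C v)
    (hcont : ContinuousOn (uncurry v) (Iio (0 : ℝ) ×ˢ univ))
    (hmild : ∀ s t : ℝ, s < t → t < 0 → ∀ x,
      v t x = UnboundedOperators.heatExtension (v s) (t - s) x - oseenDuhamel 1 s v v t x)
    (hdiv : ∀ t < 0, VectorCalculus.IsDivFree (v t))
    (hsign : ∀ s < 0, ∀ y, 0 ≤ ⟪curl (v s) y, (EuclideanSpace.single (2 : Fin 3) (1 : ℝ))⟫_ℝ)
    {s₁ : ℝ} (hs₁ : s₁ < 0)
    (htail : ∀ s < s₁, Dense {c : ℝ | ∀ ε : ℝ, 0 < ε → ∀ R₀ : ℝ, ∃ R : ℝ, R₀ ≤ R ∧ 0 < R ∧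
      ∫ y in Metric.closedBall (0 : EuclideanSpace ℝ (Fin 2)) (2 * R) \ Metric.closedBall 0 R, ‖v s (planePt c y)‖ ≤ ε * R}) :
    ∀ s < 0, ∀ y, ⟪curl (v s) y, (EuclideanSpace.single (2 : Fin 3) (1 : ℝ))⟫_ℝ = 0 := by
  -- the shifted profile `w τ = v (τ + s₁)` is in the class and satisfies the hypotheses at ALL `τ < 0`
  obtain ⟨hrate', hcont', hmild', hdiv'⟩ :=
    HalfSpaceWindowDoorCirculationCarryingRigidityCriticalStretchingAnalytic.timeShift_class hrate hcont hmild hdiv hs₁.le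
  have hsign' : ∀ τ < 0, ∀ y, 0 ≤ ⟪curl ((fun τ => v (τ + s₁)) τ) y, (EuclideanSpace.single (2 : Fin 3) (1 : ℝ))⟫_ℝ :=
    fun τ hτ y => hsign (τ + s₁) (by linarith) y
  have htail' : ∀ τ < 0, Dense {c : ℝ | ∀ ε : ℝ, 0 < ε → ∀ R₀ : ℝ, ∃ R : ℝ, R₀ ≤ R ∧ 0 < R ∧
      ∫ y in Metric.closedBall (0 : EuclideanSpace ℝ (Fin 2)) (2 * R) \ Metric.closedBall 0 R,
        ‖(fun τ => v (τ + s₁)) τ (planePt c y)‖ ≤ ε * R} :=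
    fun τ hτ => htail (τ + s₁) (by linarith)
  have hfar := inner_curl_e3_eq_zero_of_annularMean_dense C (fun τ => v (τ + s₁)) hrate' hcont' hmild' hdiv' hsign' htail'
  -- back to `v` on the ray `σ < s₁`, then forward by analyticity in time
  have hray : ∀ σ < s₁, ∀ y, ⟪curl (v σ) y, HalfSpaceWindowDoorCirculationCarryingRigidityDefs.e3⟫_ℝ = 0 := by
    intro σ hσ y
    have h := hfar (σ - s₁) (by linarith) y
    simp only [sub_add_cancel] at h
    exact h
  exact HalfSpaceWindowDoorCirculationCarryingRigidityCriticalStretchingAnalytic.inner_curl_e3_eq_zero_of_far_past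
    hrate hcont hmild hs₁ hray

end Summit.NavierStokesRegularity.NavierStokesRegularity.Theorems.HalfSpaceWindowDoorCirculationCarryingRigidityAnnularMean

end
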